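import Literature.Probability.LatticeModels.SlitEdgeDirichlet
import HarnessLib

/-!
# The edge Poisson kernel of a finite subset of `ℤ²`

Topic `Literature/Probability/LatticeModels`; continuation of `SlitEdgeDirichlet.lean` (the
edge-data Dirichlet extension `u = slitEdgeDirichletExtension S g` of two-sided boundary data
`g : Site 2 → Site 2 → ℝ` into a finite `S ⊆ ℤ²`: `u = 0` off `S`,
`4 u v = ∑_k (if v + e_k ∈ S then u (v + e_k) else g v (v + e_k))` on `S`).

Here: the extension bundled as a linear map in the data (`slitEdgeDirichletLinearMap`), and the
**edge Poisson kernel** `P_{v,k} = slitEdgePoissonKernel S v k` — the extension of the indicator of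
the single directed edge `(v, v + e_k)` — with `0 ≤ P_{v,k} ≤ 1`, the **decomposition over boundary
edges** `u = ∑_{v ∈ S} ∑_{k : v + e_k ∉ S} g v (v + e_k) · P_{v,k}`
(`slitEdgeDirichletExtension_eq_sum`, pointwise `_apply_eq_sum`) and **total mass one** on `S`
(`sum_slitEdgePoissonKernel_eq_one`); together (`slitEdgeDirichletExtension_eq_sum_weights`) they say
that `u x` is a weighted average of the boundary-edge data with nonnegative weights summing to `1`.
Consequences: **stability in the data**, global (`abs_slitEdgeDirichletExtension_sub_le`: `ε`-close
data give `ε`-close extensions) and localised (`abs_slitEdgeDirichletExtension_sub_le_sum`: the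
change at `x` is at most the edgewise change weighted by the edge Poisson kernel at `x`).

This is the analytic content of the probabilistic solution formula: for simple random walk `X` from
`x ∈ S` with exit time `τ` from the finite set `S`, `P_{v,k}(x) = P^x(X_{τ-1} = v, X_τ = v + e_k)`
and `u x = E^x[g (X_{τ-1}, X_τ)]` — the edge refinement of `f(x) = E^x[F(S_τ)]`,
G. F. Lawler, *Intersections of Random Walks* (1991), Thm 1.4.5, and of the vertex Poisson kernel
`H_A(x, y) = P^x(S_{τ_A} = y)` (Lawler–Limic 2010, §6.2); the edge-data problem itself is the case
`F = 0` of the inhomogeneous problem `Δ f = -g` of Lawler 1991, Thm 1.4.6 (with source the edge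
boundary sum). The walk is not formalised here; all statements are proved by linearity, locality in
the data and the maximum principle of `SlitEdgeDirichlet.lean`, and are [folklore].
-/

noncomputable section

namespace Literature.Probability.LatticeModels

open Finset

variable {S : Set (Site 2)}

/-! ### The extension as a linear map -/

/-- The edge-data Dirichlet extension as a **linear map** in the data (finite `S`). [folklore] -/
def slitEdgeDirichletLinearMap (hS : S.Finite) : (Site 2 → Site 2 → ℝ) →ₗ[ℝ] (Site 2 → ℝ) where
  toFun := slitEdgeDirichletExtension S
  map_add' := slitEdgeDirichletExtension_add hS
  map_smul' c g := by rw [RingHom.id_apply]; exact slitEdgeDirichletExtension_smul hS c g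

/-- The linear map is the extension. [folklore] -/
@[simp] theorem slitEdgeDirichletLinearMap_apply (hS : S.Finite) (g : Site 2 → Site 2 → ℝ) :
    slitEdgeDirichletLinearMap hS g = slitEdgeDirichletExtension S g := rfl

/-! ### The edge Poisson kernel -/

/-- The **edge Poisson kernel** (edge harmonic measure) of `S`: `slitEdgePoissonKernel S v k` is the
edge-data Dirichlet extension of the datum `1` on the single directed edge `(v, v + e_k)` and `0` on
all others. For `S` finite, `v ∈ S`, `v + e_k ∉ S`, its value at `x ∈ S` is the probability that
simple random walk from `x` leaves `S` through that edge (not formalised; cf. the vertex Poisson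
kernel `H_A(x, y) = P^x(S_{τ_A} = y)`, Lawler–Limic 2010, §6.2). [folklore] -/
def slitEdgePoissonKernel (S : Set (Site 2)) (v : Site 2) (k : Fin 4) : Site 2 → ℝ :=
  slitEdgeDirichletExtension S (fun v' w' => if v' = v ∧ w' = v + cornerUnit k then 1 else 0)

/-- The edge Poisson kernel is nonnegative. [folklore] -/
theorem slitEdgePoissonKernel_nonneg (hS : S.Finite) (v : Site 2) (k : Fin 4) (x : Site 2) :
    0 ≤ slitEdgePoissonKernel S v k x :=
  slitEdgeDirichletExtension_nonneg hS (fun _ _ _ _ => by positivity) x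

/-- The edge Poisson kernel is at most `1`. [folklore] -/
theorem slitEdgePoissonKernel_le_one (hS : S.Finite) (v : Site 2) (k : Fin 4) (x : Site 2) :
    slitEdgePoissonKernel S v k x ≤ 1 := by
  by_cases hx : x ∈ S
  · exact slitEdgeDirichletExtension_le_of_forall_le hS
      (fun _ _ _ _ => by split_ifs <;> norm_num) x hx
  · rw [slitEdgePoissonKernel, slitEdgeDirichletExtension_eq_zero_of_not_mem _ hx]
    exact zero_le_one

/-- The edge Poisson kernel vanishes off `S`. [folklore] -/
theorem slitEdgePoissonKernel_eq_zero_of_not_mem (v : Site 2) (k : Fin 4) {x : Site 2}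
    (hx : x ∉ S) : slitEdgePoissonKernel S v k x = 0 :=
  slitEdgeDirichletExtension_eq_zero_of_not_mem _ hx

open scoped Classical in
/-- **Decomposition over boundary edges**: on a finite set,
`u = ∑_{v ∈ S} ∑_{k : v + e_k ∉ S} g v (v + e_k) · P_{v,k}` (linearity and locality in the data) —
the analytic form of `u x = E_x[g (X_{τ-1}, X_τ)]`. [folklore] -/
theorem slitEdgeDirichletExtension_eq_sum (hS : S.Finite) (g : Site 2 → Site 2 → ℝ) :
    slitEdgeDirichletExtension S g = ∑ v ∈ hS.toFinset, ∑ k : Fin 4,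
      if v + cornerUnit k ∈ S then 0 else g v (v + cornerUnit k) • slitEdgePoissonKernel S v k := by
  -- the data agree on boundary edges with the corresponding combination of edge indicators
  set δ : Site 2 → Fin 4 → Site 2 → Site 2 → ℝ :=
    fun v k v' w' => if v' = v ∧ w' = v + cornerUnit k then 1 else 0 with hδ
  have hdata : ∀ v ∈ S, ∀ k : Fin 4, v + cornerUnit k ∉ S → g v (v + cornerUnit k) =
      (∑ v' ∈ hS.toFinset, ∑ k' : Fin 4,
        if v' + cornerUnit k' ∈ S then (0 : Site 2 → Site 2 → ℝ)
        else g v' (v' + cornerUnit k') • δ v' k') v (v + cornerUnit k) := by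
    intro v hv k hk
    simp only [Finset.sum_apply, ite_apply, Pi.zero_apply, Pi.smul_apply, smul_eq_mul, hδ]
    rw [Finset.sum_eq_single_of_mem v (hS.mem_toFinset.2 hv)]
    · rw [Finset.sum_eq_single_of_mem k (Finset.mem_univ k)]
      · simp [hk]
      · intro k' _ hk'
        have hne : ¬(v + cornerUnit k = v + cornerUnit k') := by
          rw [add_right_inj]
          exact fun h => hk' (cornerUnit_injective h).symm
        simp [hne]
    · intro v' _ hv'
      refine Finset.sum_eq_zero fun k' _ => ?_
      simp [Ne.symm hv']
  rw [slitEdgeDirichletExtension_congr hdata, slitEdgeDirichletExtension_sum hS]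
  refine Finset.sum_congr rfl fun v' _ => ?_
  rw [slitEdgeDirichletExtension_sum hS]
  refine Finset.sum_congr rfl fun k' _ => ?_
  split_ifs
  · exact slitEdgeDirichletExtension_zero hS
  · rw [slitEdgeDirichletExtension_smul hS]
    rfl

open scoped Classical in
/-- Pointwise form of the decomposition: `u x = ∑_{v ∈ S} ∑_{k : v + e_k ∉ S} g v (v + e_k) P_{v,k}(x)`.
[folklore] -/
theorem slitEdgeDirichletExtension_apply_eq_sum (hS : S.Finite) (g : Site 2 → Site 2 → ℝ)
    (x : Site 2) :
    slitEdgeDirichletExtension S g x = ∑ v ∈ hS.toFinset, ∑ k : Fin 4,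
      if v + cornerUnit k ∈ S then 0 else g v (v + cornerUnit k) * slitEdgePoissonKernel S v k x := by
  rw [slitEdgeDirichletExtension_eq_sum hS g]
  simp only [Finset.sum_apply, ite_apply, Pi.zero_apply, Pi.smul_apply, smul_eq_mul]

open scoped Classical in
/-- **Total mass one**: at a site of the finite set `S` the edge Poisson kernels of the boundary
edges sum to `1` (the exit edge of the walk is some boundary edge). [folklore] -/
theorem sum_slitEdgePoissonKernel_eq_one (hS : S.Finite) {x : Site 2} (hx : x ∈ S) :
    (∑ v ∈ hS.toFinset, ∑ k : Fin 4,
      if v + cornerUnit k ∈ S then 0 else slitEdgePoissonKernel S v k x) = 1 := by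
  have h := slitEdgeDirichletExtension_apply_eq_sum hS (fun _ _ => (1 : ℝ)) x
  rw [slitEdgeDirichletExtension_const hS 1 hx] at h
  rw [h]
  simp only [one_mul]

open scoped Classical in
/-- **The extension is a weighted average of the edge data**: with nonnegative weights of total mass
one — the maximum principle again, in barycentric form. [folklore] -/
theorem slitEdgeDirichletExtension_eq_sum_weights (hS : S.Finite) (g : Site 2 → Site 2 → ℝ)
    {x : Site 2} (hx : x ∈ S) :
    ∃ w : Site 2 → Fin 4 → ℝ, (∀ v k, 0 ≤ w v k) ∧
      (∑ v ∈ hS.toFinset, ∑ k : Fin 4, if v + cornerUnit k ∈ S then 0 else w v k) = 1 ∧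
      slitEdgeDirichletExtension S g x =
        ∑ v ∈ hS.toFinset, ∑ k : Fin 4,
          if v + cornerUnit k ∈ S then 0 else g v (v + cornerUnit k) * w v k :=
  ⟨fun v k => slitEdgePoissonKernel S v k x, fun v k => slitEdgePoissonKernel_nonneg hS v k x,
    sum_slitEdgePoissonKernel_eq_one hS hx, slitEdgeDirichletExtension_apply_eq_sum hS g x⟩

/-! ### Stability in the data -/

/-- **Stability**: data that are `ε`-close on the boundary edges have `ε`-close extensions on `S`
(linearity and the maximum principle). [folklore] -/
theorem abs_slitEdgeDirichletExtension_sub_le (hS : S.Finite) {g₁ g₂ : Site 2 → Site 2 → ℝ}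
    {ε : ℝ} (h : ∀ v ∈ S, ∀ k : Fin 4, v + cornerUnit k ∉ S →
      |g₁ v (v + cornerUnit k) - g₂ v (v + cornerUnit k)| ≤ ε) :
    ∀ v ∈ S, |slitEdgeDirichletExtension S g₁ v - slitEdgeDirichletExtension S g₂ v| ≤ ε := by
  intro v hv
  have key := abs_slitEdgeDirichletExtension_le hS (g := g₁ - g₂) (M := ε)
    (fun v hv k hk => by simpa using h v hv k hk) v hv
  rwa [slitEdgeDirichletExtension_sub hS, Pi.sub_apply] at key

open scoped Classical in
/-- **Localised stability**: the effect at `x` of changing the data is bounded by the change on each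
boundary edge weighted by that edge's Poisson kernel at `x` — data changed only on edges of small
harmonic measure seen from `x` move `u x` little. [folklore] -/
theorem abs_slitEdgeDirichletExtension_sub_le_sum (hS : S.Finite) (g₁ g₂ : Site 2 → Site 2 → ℝ)
    (x : Site 2) :
    |slitEdgeDirichletExtension S g₁ x - slitEdgeDirichletExtension S g₂ x| ≤
      ∑ v ∈ hS.toFinset, ∑ k : Fin 4, if v + cornerUnit k ∈ S then 0
        else |g₁ v (v + cornerUnit k) - g₂ v (v + cornerUnit k)| * slitEdgePoissonKernel S v k x := by
  rw [← Pi.sub_apply, ← slitEdgeDirichletExtension_sub hS,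
    slitEdgeDirichletExtension_apply_eq_sum hS (g₁ - g₂) x]
  refine (Finset.abs_sum_le_sum_abs _ _).trans (Finset.sum_le_sum fun v _ => ?_)
  refine (Finset.abs_sum_le_sum_abs _ _).trans (Finset.sum_le_sum fun k _ => ?_)
  split_ifs
  · simp
  · rw [abs_mul, abs_of_nonneg (slitEdgePoissonKernel_nonneg hS v k x)]
    rfl

end Literature.Probability.LatticeModels
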